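import Summits.QuantumFields.GaugeBoot.LoopEquation
import HarnessLib

/-!
# Gauge-boot: the single-link loop equation AT THE LEVEL OF FUNCTIONALS — every linear functional with the
# Schwinger–Dyson pair rows satisfies `Σ_k φ(splitTerm_k) + (β/2)·Σ φ(plaqTerm) = 0` (large-`N` supplement 18, part 5a)

HONEST FRAMING (cell `pub-gaugeboot`, page 1 of every file): certified bounds on lattice
expectations at STATED coupling, gauge group, dimension and torus size; NOT a mass gap, NOT a
continuum limit, NOT a string tension, NOT large `N`; NOT Yang–Mills-summit-bearing (barriers
`FixedCouplingUltralocality`, `PerturbativeInvisibility`).  Structural (what an SDP-feasible point satisfies);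
it certifies no number.

## Content

The lane's `LoopEquation.loopEquation_of_sdPair` contracts the one-link Schwinger–Dyson PAIR IDENTITY over the
matrix units for Wilson's MEASURE.  The contraction is pointwise linear algebra, so it applies verbatim to any
LINEAR FUNCTIONAL `φ : C(GaugeConfig, ℝ) →ₗ ℝ` in place of `∫ · dμ_β` — in particular to every feasible point of the
cell's truncated bootstrap SDPs (part 5c):

* `evalR φ f`, `evalC φ F` — evaluation of `φ` at a (continuous) real observable given as a bare function, and its
  complexification `φ(Re F) + i φ(Im F)`; linearity (`evalR_add/smul/sum`, `evalC_add/smul/sum`, `evalC_re`);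
* `SDPairF r φ β x μ x₀ w X` — THE PAIR ROW for the functional: for every `Y`,
  `Φ(tr(Y·insDeriv_X hol_w)) = β·Φ(tr(Y ρ(hol_w))·(−½ plaqIns_X))` (`Φ = evalC φ`);
* `sdPairF_of_parts / _of_traceless / _of_skew` — polarisation: both sides are `ℂ`-linear in `X`
  (the lane's `insDeriv_add/smul`, `plaqIns_add/smul`), so rows for (traceless) skew-Hermitian `X` give rows for
  all (traceless) `X`;
* ★★ `loopEquationF_of_sdPairF` — for a word `w` closed at `x` and a weight `s` with the rows for all
  `E_ij − (s/N)δ_ij`: `Σ_k Φ(splitTerm_k) + (β/2)·Σ_{ν≠μ,ε} Φ(plaqTerm_{ν,ε}) = 0`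
  (the lane's `sum_trace_insDeriv_unitDir`, `sum_trace_mul_plaqIns_unitDir`, with `Φ` for `∫`).

[folklore] (Makeenko–Migdal / Kazakov–Zheng loop equations as linear constraints on a putative state.)
-/

noncomputable section

open Filter Topology NormedSpace
open scoped Matrix.Norms.Frobenius Matrix
open Literature.MathematicalPhysics.QuantumFieldTheory
open Summit.QuantumFields.YangMills.Cruxes.CurvatureAmnesia.WardDefect.SchwingerDyson

namespace Summit.QuantumFields.GaugeBoot

/-! ## Evaluating a functional at bare (continuous) functions -/

section Eval

variable {X : Type*} [TopologicalSpace X] (φ : C(X, ℝ) →ₗ[ℝ] ℝ)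

/-- Evaluation of `φ` at a real function given unbundled (junk `0` if it is not continuous). [folklore] -/
def evalR (f : X → ℝ) : ℝ := by
  classical
  exact if h : Continuous f then φ ⟨f, h⟩ else 0

/-- On a continuous function, `evalR` is `φ` of the bundled map. [folklore] -/
theorem evalR_eq {f : X → ℝ} (hf : Continuous f) : evalR φ f = φ ⟨f, hf⟩ := by
  unfold evalR; rw [dif_pos hf]

/-- On a bundled continuous map, `evalR` is `φ`. [folklore] -/
theorem evalR_coe (g : C(X, ℝ)) : evalR φ g = φ g := by
  cases g with
  | mk g hg => exact evalR_eq φ hg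

/-- Additivity. [folklore] -/
theorem evalR_add {f g : X → ℝ} (hf : Continuous f) (hg : Continuous g) :
    evalR φ (fun x => f x + g x) = evalR φ f + evalR φ g := by
  have h : Continuous fun x => f x + g x := hf.add hg
  rw [evalR_eq φ h, evalR_eq φ hf, evalR_eq φ hg, ← map_add]
  rfl

/-- Homogeneity. [folklore] -/
theorem evalR_smul (c : ℝ) {f : X → ℝ} (hf : Continuous f) : evalR φ (fun x => c * f x) = c * evalR φ f := by
  have h : Continuous fun x => c * f x := continuous_const.mul hf
  rw [evalR_eq φ h, evalR_eq φ hf, ← smul_eq_mul c (φ _), ← map_smul]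
  rfl

/-- Subtraction. [folklore] -/
theorem evalR_sub {f g : X → ℝ} (hf : Continuous f) (hg : Continuous g) :
    evalR φ (fun x => f x - g x) = evalR φ f - evalR φ g := by
  have h : Continuous fun x => f x - g x := hf.sub hg
  rw [evalR_eq φ h, evalR_eq φ hf, evalR_eq φ hg, ← map_sub]
  rfl

/-- Finite sums. [folklore] -/
theorem evalR_sum {ι : Type*} (s : Finset ι) (f : ι → X → ℝ) (hf : ∀ i, Continuous (f i)) :
    evalR φ (fun x => ∑ i ∈ s, f i x) = ∑ i ∈ s, evalR φ (f i) := by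
  rw [evalR_eq φ (continuous_finsetSum s fun i _ => hf i)]
  have h : (⟨fun x => ∑ i ∈ s, f i x, continuous_finsetSum s fun i _ => hf i⟩ : C(X, ℝ)) =
      ∑ i ∈ s, ⟨f i, hf i⟩ := by
    ext x; simp
  rw [h, map_sum]
  exact Finset.sum_congr rfl fun i _ => (evalR_eq φ (hf i)).symm

/-- Constants, for a normalised functional. [folklore] -/
theorem evalR_const (h1 : φ 1 = 1) (c : ℝ) : evalR φ (fun _ => c) = c := by
  rw [evalR_eq φ continuous_const]
  have h : (⟨fun _ => c, continuous_const⟩ : C(X, ℝ)) = c • (1 : C(X, ℝ)) := by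
    ext x; simp
  rw [h, map_smul, h1, smul_eq_mul, mul_one]

/-- The complexification `Φ(F) = φ(Re F) + i·φ(Im F)` of `φ`, on unbundled complex observables. [folklore] -/
def evalC (F : X → ℂ) : ℂ :=
  (evalR φ (fun x => (F x).re) : ℂ) + (evalR φ (fun x => (F x).im) : ℂ) * Complex.I

/-- Real part of the complexification. [folklore] -/
@[simp] theorem evalC_re (F : X → ℂ) : (evalC φ F).re = evalR φ (fun x => (F x).re) := by
  simp [evalC]

/-- Imaginary part of the complexification. [folklore] -/
@[simp] theorem evalC_im (F : X → ℂ) : (evalC φ F).im = evalR φ (fun x => (F x).im) := by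
  simp [evalC]

/-- Additivity of `Φ`. [folklore] -/
theorem evalC_add {F G : X → ℂ} (hF : Continuous F) (hG : Continuous G) :
    evalC φ (fun x => F x + G x) = evalC φ F + evalC φ G := by
  apply Complex.ext
  · simp only [evalC_re, Complex.add_re]
    exact evalR_add φ (Complex.continuous_re.comp hF) (Complex.continuous_re.comp hG)
  · simp only [evalC_im, Complex.add_im]
    exact evalR_add φ (Complex.continuous_im.comp hF) (Complex.continuous_im.comp hG)

/-- `ℂ`-homogeneity of `Φ`. [folklore] -/
theorem evalC_smul (c : ℂ) {F : X → ℂ} (hF : Continuous F) : evalC φ (fun x => c * F x) = c * evalC φ F := by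
  have hre : Continuous fun x => (F x).re := Complex.continuous_re.comp hF
  have him : Continuous fun x => (F x).im := Complex.continuous_im.comp hF
  have h1 : Continuous fun x => c.re * (F x).re := continuous_const.mul hre
  have h2 : Continuous fun x => c.im * (F x).im := continuous_const.mul him
  have h3 : Continuous fun x => c.re * (F x).im := continuous_const.mul him
  have h4 : Continuous fun x => c.im * (F x).re := continuous_const.mul hre
  apply Complex.ext
  · simp only [evalC_re, Complex.mul_re, evalC_im]
    rw [evalR_sub φ h1 h2, evalR_smul φ _ hre, evalR_smul φ _ him]
  · simp only [evalC_im, Complex.mul_im, evalC_re]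
    rw [evalR_add φ h3 h4, evalR_smul φ _ him, evalR_smul φ _ hre]

/-- Finite sums under `Φ`. [folklore] -/
theorem evalC_sum {ι : Type*} (s : Finset ι) (F : ι → X → ℂ) (hF : ∀ i, Continuous (F i)) :
    evalC φ (fun x => ∑ i ∈ s, F i x) = ∑ i ∈ s, evalC φ (F i) := by
  apply Complex.ext
  · rw [evalC_re, Complex.re_sum]
    simp only [Complex.re_sum, evalC_re]
    exact evalR_sum φ s _ fun i => Complex.continuous_re.comp (hF i)
  · rw [evalC_im, Complex.im_sum]
    simp only [Complex.im_sum, evalC_im]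
    exact evalR_sum φ s _ fun i => Complex.continuous_im.comp (hF i)

/-- `Φ` only depends on the function. [folklore] -/
theorem evalC_congr {F G : X → ℂ} (h : ∀ x, F x = G x) : evalC φ F = evalC φ G := by
  rw [show F = G from funext h]

end Eval

/-! ## The pair row for a functional, and polarisation -/

section PairRow

variable {d L : ℕ} {G : Type} [Group G] [TopologicalSpace G] [IsTopologicalGroup G] (r : LatticeRep G)
  (φ : C(GaugeConfig d L G, ℝ) →ₗ[ℝ] ℝ)

/-- THE PAIR ROW of the functional `φ` for the direction `X` (word `w` from `x₀`, edge `(x, μ)`, coupling `β`):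
for every `Y`, `Φ(tr(Y·insDeriv_X hol_w)) = β·Φ(tr(Y ρ(hol_w))·(−½ plaqIns_X))`, `Φ = evalC φ` — the lane's
`SDPair` with the functional in place of Wilson's measure. [shape] A parametric definition of a proposition — NOT a
fact. [folklore] -/
def SDPairF [NeZero L] (β : ℝ) (x : Site d L) (μ : Fin d) (x₀ : Site d L) (w : Word d)
    (X : Matrix (Fin r.N) (Fin r.N) ℂ) : Prop :=
  ∀ Y : Matrix (Fin r.N) (Fin r.N) ℂ,
    evalC φ (fun U => (Y * insDeriv r.ρ (x, μ) X U x₀ w).trace) =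
      (β : ℂ) * evalC φ (fun U => (Y * r.ρ (wordHolonomy U x₀ w)).trace * (-(1 / 2) * plaqIns r.ρ X U x μ))

/-- **Polarisation step**: the pair row for the two skew-Hermitian parts of `X` implies it for `X` (both sides are
`ℂ`-linear in `X`). [folklore] -/
theorem sdPairF_of_parts [NeZero L] (β : ℝ) (x : Site d L) (μ : Fin d) (x₀ : Site d L) (w : Word d)
    (X : Matrix (Fin r.N) (Fin r.N) ℂ) (hPA : SDPairF r φ β x μ x₀ w ((1 / 2 : ℂ) • (X - Xᴴ)))
    (hPB : SDPairF r φ β x μ x₀ w ((Complex.I / 2) • (X + Xᴴ))) : SDPairF r φ β x μ x₀ w X := by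
  set A : Matrix (Fin r.N) (Fin r.N) ℂ := (1 / 2 : ℂ) • (X - Xᴴ) with hA
  set B : Matrix (Fin r.N) (Fin r.N) ℂ := (Complex.I / 2) • (X + Xᴴ) with hB
  have hXAB : X = A + (-Complex.I) • B := eq_skewPart_add X
  clear_value A B
  intro Y
  have hiA := continuous_trace_mul_insDeriv r Y A (x, μ) x₀ w
  have hiB := continuous_trace_mul_insDeriv r Y B (x, μ) x₀ w
  have hjA := continuous_rhsIntegrand r Y A x μ x₀ w
  have hjB := continuous_rhsIntegrand r Y B x μ x₀ w
  have hiB' : Continuous fun U : GaugeConfig d L G => (-Complex.I) * (Y * insDeriv r.ρ (x, μ) B U x₀ w).trace :=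
    continuous_const.mul hiB
  have hjB' : Continuous fun U : GaugeConfig d L G =>
      (-Complex.I) * ((Y * r.ρ (wordHolonomy U x₀ w)).trace * (-(1 / 2) * plaqIns r.ρ B U x μ)) :=
    continuous_const.mul hjB
  have hl : ∀ U : GaugeConfig d L G, (Y * insDeriv r.ρ (x, μ) X U x₀ w).trace =
      (Y * insDeriv r.ρ (x, μ) A U x₀ w).trace + (-Complex.I) * (Y * insDeriv r.ρ (x, μ) B U x₀ w).trace := by
    intro U
    rw [hXAB, insDeriv_add, insDeriv_smul, Matrix.mul_add, Matrix.mul_smul, Matrix.trace_add, Matrix.trace_smul,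
      smul_eq_mul]
  have hr : ∀ U : GaugeConfig d L G,
      (Y * r.ρ (wordHolonomy U x₀ w)).trace * (-(1 / 2) * plaqIns r.ρ X U x μ) =
        (Y * r.ρ (wordHolonomy U x₀ w)).trace * (-(1 / 2) * plaqIns r.ρ A U x μ) +
          (-Complex.I) * ((Y * r.ρ (wordHolonomy U x₀ w)).trace * (-(1 / 2) * plaqIns r.ρ B U x μ)) := by
    intro U
    rw [hXAB, plaqIns_add, plaqIns_smul]
    ring
  rw [evalC_congr φ hl, evalC_congr φ hr, evalC_add φ hiA hiB', evalC_smul φ _ hiB,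
    evalC_add φ hjA hjB', evalC_smul φ _ hjB, hPA Y, hPB Y]
  ring

/-- **Polarisation (`𝔰𝔲`-type)**: rows for all traceless skew-Hermitian directions give rows for all traceless
directions. [folklore] -/
theorem sdPairF_of_traceless [NeZero L] (β : ℝ) (x : Site d L) (μ : Fin d) (x₀ : Site d L) (w : Word d)
    (hadm : ∀ X : Matrix (Fin r.N) (Fin r.N) ℂ, Xᴴ = -X → X.trace = 0 → SDPairF r φ β x μ x₀ w X)
    (X : Matrix (Fin r.N) (Fin r.N) ℂ) (hX : X.trace = 0) : SDPairF r φ β x μ x₀ w X :=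
  sdPairF_of_parts r φ β x μ x₀ w X (hadm _ (conjTranspose_skewPart X) (trace_parts_eq_zero hX _).1)
    (hadm _ (conjTranspose_iHermPart X) (trace_parts_eq_zero hX _).2)

/-- **Polarisation (`𝔲`-type)**: rows for all skew-Hermitian directions give rows for all directions. [folklore] -/
theorem sdPairF_of_skew [NeZero L] (β : ℝ) (x : Site d L) (μ : Fin d) (x₀ : Site d L) (w : Word d)
    (hadm : ∀ X : Matrix (Fin r.N) (Fin r.N) ℂ, Xᴴ = -X → SDPairF r φ β x μ x₀ w X)
    (X : Matrix (Fin r.N) (Fin r.N) ℂ) : SDPairF r φ β x μ x₀ w X :=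
  sdPairF_of_parts r φ β x μ x₀ w X (hadm _ (conjTranspose_skewPart X)) (hadm _ (conjTranspose_iHermPart X))

/-! ## The contraction: the loop equation for the functional -/

/-- ★★ **THE SINGLE-LINK LOOP EQUATION FOR A FUNCTIONAL.**  If `φ` has the pair rows for every direction
`E_ij − (s/N)δ_ij` (word `w` closed at the source `x` of the edge `(x, μ)`), then
`Σ_k Φ(splitTerm_k) + (β/2)·Σ_{ν≠μ} Σ_ε Φ(plaqTerm_{ν,ε}) = 0` — the lane's loop equation with `Φ = evalC φ` in
place of the Wilson expectation. [folklore] -/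
theorem loopEquationF_of_sdPairF [NeZero L] (β : ℝ) (x : Site d L) (μ : Fin d) (s : ℂ) (w : Word d)
    (hw : Word.endpoint x w = x) (hP : ∀ i j : Fin r.N, SDPairF r φ β x μ x w (unitDir s i j)) :
    (∑ k ∈ Finset.range w.length, evalC φ (fun U => splitTerm r.ρ s x μ U w k)) +
      (β / 2 : ℂ) * ∑ ν ∈ Finset.univ.erase μ, ∑ ε : Bool,
        evalC φ (fun U => plaqTerm r.ρ s x μ U w ν ε) = 0 := by
  have hf : ∀ i j : Fin r.N, Continuous
      (fun U : GaugeConfig d L G => (Matrix.single j i (1 : ℂ) * insDeriv r.ρ (x, μ) (unitDir s i j) U x w).trace) :=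
    fun i j => continuous_trace_mul_insDeriv r _ _ (x, μ) x w
  have hg : ∀ i j : Fin r.N, Continuous (fun U : GaugeConfig d L G =>
      (Matrix.single j i (1 : ℂ) * r.ρ (wordHolonomy U x w)).trace * (-(1 / 2) * plaqIns r.ρ (unitDir s i j) U x μ)) :=
    fun i j => continuous_rhsIntegrand r _ _ x μ x w
  have h1 : evalC φ (fun U => ∑ k ∈ Finset.range w.length, splitTerm r.ρ s x μ U w k) =
      (β : ℂ) * evalC φ (fun U => -(1 / 2) * ∑ ν ∈ Finset.univ.erase μ, ∑ ε : Bool, plaqTerm r.ρ s x μ U w ν ε) := by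
    calc evalC φ (fun U => ∑ k ∈ Finset.range w.length, splitTerm r.ρ s x μ U w k)
        = evalC φ (fun U => ∑ i : Fin r.N, ∑ j : Fin r.N,
            (Matrix.single j i (1 : ℂ) * insDeriv r.ρ (x, μ) (unitDir s i j) U x w).trace) :=
          evalC_congr φ fun U => (sum_trace_insDeriv_unitDir s x μ U w).symm
      _ = ∑ i : Fin r.N, ∑ j : Fin r.N,
            evalC φ (fun U => (Matrix.single j i (1 : ℂ) * insDeriv r.ρ (x, μ) (unitDir s i j) U x w).trace) := by
          rw [evalC_sum φ _ _ fun i => continuous_finsetSum _ fun j _ => hf i j]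
          exact Finset.sum_congr rfl fun i _ => evalC_sum φ _ _ fun j => hf i j
      _ = ∑ i : Fin r.N, ∑ j : Fin r.N, (β : ℂ) * evalC φ (fun U =>
            (Matrix.single j i (1 : ℂ) * r.ρ (wordHolonomy U x w)).trace *
              (-(1 / 2) * plaqIns r.ρ (unitDir s i j) U x μ)) :=
          Finset.sum_congr rfl fun i _ => Finset.sum_congr rfl fun j _ => hP i j (Matrix.single j i 1)
      _ = (β : ℂ) * ∑ i : Fin r.N, ∑ j : Fin r.N, evalC φ (fun U =>
            (Matrix.single j i (1 : ℂ) * r.ρ (wordHolonomy U x w)).trace *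
              (-(1 / 2) * plaqIns r.ρ (unitDir s i j) U x μ)) := by
          simp only [Finset.mul_sum]
      _ = (β : ℂ) * evalC φ (fun U => ∑ i : Fin r.N, ∑ j : Fin r.N,
            (Matrix.single j i (1 : ℂ) * r.ρ (wordHolonomy U x w)).trace *
              (-(1 / 2) * plaqIns r.ρ (unitDir s i j) U x μ)) := by
          rw [evalC_sum φ _ _ fun i => continuous_finsetSum _ fun j _ => hg i j]
          congr 1
          exact (Finset.sum_congr rfl fun i _ => evalC_sum φ _ _ fun j => hg i j).symm
      _ = (β : ℂ) * evalC φ (fun U => -(1 / 2) * ∑ ν ∈ Finset.univ.erase μ, ∑ ε : Bool, plaqTerm r.ρ s x μ U w ν ε) := by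
          congr 1
          exact evalC_congr φ fun U => sum_trace_mul_plaqIns_unitDir s x μ U w hw
  have h2 : evalC φ (fun U => ∑ k ∈ Finset.range w.length, splitTerm r.ρ s x μ U w k) =
      ∑ k ∈ Finset.range w.length, evalC φ (fun U => splitTerm r.ρ s x μ U w k) :=
    evalC_sum φ _ _ fun k => continuous_splitTerm r s x μ w k
  have h3 : evalC φ (fun U => -(1 / 2) * ∑ ν ∈ Finset.univ.erase μ, ∑ ε : Bool, plaqTerm r.ρ s x μ U w ν ε) =
      -(1 / 2) * ∑ ν ∈ Finset.univ.erase μ, ∑ ε : Bool, evalC φ (fun U => plaqTerm r.ρ s x μ U w ν ε) := by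
    rw [evalC_smul φ _ (continuous_finsetSum _ fun ν _ => continuous_finsetSum _ fun ε _ =>
      continuous_plaqTerm r s x μ w ν ε)]
    congr 1
    rw [evalC_sum φ _ _ fun ν => continuous_finsetSum _ fun ε _ => continuous_plaqTerm r s x μ w ν ε]
    exact Finset.sum_congr rfl fun ν _ => evalC_sum φ _ _ fun ε => continuous_plaqTerm r s x μ w ν ε
  rw [← h2, h1, h3]
  ring

end PairRow

end Summit.QuantumFields.GaugeBoot

end
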